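import Summits.KontsevichZagierPeriods.Zeta5Search.Barrier.ConeGammaLogCuspGammaUniform
import Summits.KontsevichZagierPeriods.Zeta5Search.Barrier.ConeGammaCuspModulusLocal

/-!
# ζ(5) search — BARRIER: `Λ` DECIDES `γ`'S LOCAL MAXIMALITY ON THE SLICE AT A REGULAR DIRECTION — `Λ < 0 ⇒ γ(s(a)+η) < γ(a)`, an ascent ray `⇒` not

HONEST FRAMING (cell `pub-zeta5`): systematic search; no irrationality claim unless kernel-certified. MODEL objects
under Brown–Zudilin's (28)+(30) accounting ([BZ22] = arXiv:2210.03391; (28) observed, not proved): the rate function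
`γ = (C₁ − C₀)/(C₁ + δ₂₈ − Φ)` of `ConeGammaRates` near a rational direction. Nothing here is a statement about
`ζ(5)`, any `γ` OF RECORD, the cone's supremum (C2 = `BarrierC2`, OPEN) or the value / sign of the cusp slope or of
the modulus at a named direction — at the cell's four named directions (record/41, flag/60, argmax-120, t*/480) ASCENT
RAYS EXIST (DATA of P2 g11/g34–g36, relay 268), so NO named direction is asserted to be a local maximiser of anything
and the local-maximum half below applies to none of them — there «Regular» and «open box» are kernel facts on cert-2's
`r = 1/200` boxes (`regular_box_*_200`, NOT imported here, named only as the reason the hypotheses hold on those boxes),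
`Q > 0` stays a hypothesis and `Λ > 0` is DATA; every «local maximum» below is a GERM statement (`IsLocalMaxOn`) whose
quantitative radius is Lemma B's coherence radius ∩ P2 g23's stability radius — NOT S-E's covering ball; the lemma
S-E / S-E′ stays CONJECTURED; records in print UNMOVED. Prover P2 g38, file (2) of three of the item «`γ` INHERITS THE
LOCAL MAXIMUM» (P2 g37's successor menu (a)), theorems only; file (3) (`ConeGammaGammaLocalMax`) passes from the slice
to `IsLocalMax γ a` on `Dir`.

THE POINT. `BARRIER-PLAN.md` §2b states S-E′ («resonance dominance») with the clause «rational directions are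
cusp-type local MAXIMA of `Φ` (and hence of `γ`, since `C₀`, `C₁`, `δ₂₈` are Lipschitz there and `∂γ/∂Φ > 0`)».
P2 g37 proved the `Φ`-half on the slice `{η₀ = 0}` from `Λ < 0` (`ConeGammaCuspModulusLocal`, Lemma B's coherence
ball). FILES (2)–(3) PROVE THE «AND HENCE OF `γ`» CLAUSE AS A THEOREM, UNCONDITIONALLY AT REGULAR OPEN-BOX DIRECTIONS
WITH `Q = C₁ + δ₂₈ − Φ > 0` (this file: on the slice `{η₀ = 0}`; file (3): on `Dir`): the Lipschitz behaviour of
`C₁`, `C₀` is P2 g23's `regular_stable`, `δ₂₈`'s is the tree's, `∂γ/∂Φ = (C₁−C₀)/Q² > 0` is `C0_lt_C1_of_regular`,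
and file (1)'s `gamma_logCusp_nhds_of_regular` is the uniform expansion. With P2 g36's global ascent modulus `Λ(a,T)`
(written out: «`σ(x)` for an `x` carrying the modulus bound») and the rate spread `r_M(η) − r_m(η)`:
* **`gamma_sub_le_modulus_nhds_of_regular`** — `Λ` CONTROLS `γ` TO FIRST ORDER ON THE BALL:
  `γ(s(a)+η) − γ(a) ≤ (∂γ/∂Φ)·(σ(x)/T)·spread(η)·log(1/Y(η)) + C′·Y(η)` for every `0 < Y(η) ≤ r`, either sign;
* **`gamma_sub_le_neg_on_slice_of_regular`**, **`gamma_lt_on_slice_of_modulus_neg_of_regular`** — `Λ < 0 ⇒` on the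
  slice `η₀ = 0`: `γ(s(a)+η) − γ(a) ≤ −B·Y·log(1/Y) + C′·Y` with `B = (∂γ/∂Φ)·|Λ|/(T·κ) > 0`
  (`κ = x_max + 3x_max²/(2s₀)`, the slice norm constant of P2 g37), hence `γ(s(a)+η) < γ(a)` for all `η₀ = 0`,
  `0 < Y(η) ≤ r` — the S-E′ shape FOR `γ` on Lemma B's coherence ball;
* **`exists_gamma_gt_on_slice_of_cuspSlope_pos_of_regular`** — conversely ONE ascent direction (`σ(x) > 0`) gives,
  inside every `Y`-ball, a slice displacement with `γ(s(a)+η) > γ(a)`;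
* **`gamma_lt_on_slice_of_strict_of_regular`**, **`gamma_slice_dichotomy_of_regular`**, `isLocalMaxOn_gamma_slice…`,
  `not_isLocalMaxOn_gamma_slice…` — packaged with the modulus ray (`exists_modulus_ray_canonical`): STRICT CUSP TOP
  (`σ < 0` off the radial line `⇔ Λ < 0`) `⇒ γ(s(a)+η) < γ(a)` on the slice near `0`; an ascent direction `⇒` no
  local maximum on the slice, in Mathlib's words `IsLocalMaxOn (η ↦ γ(aOfS(s(a)+η))) {η | η₀ = 0} 0`, resp. `¬` — germ
  statements whose quantitative radius is Lemma B's coherence radius ∩ g23's stability radius, NOT S-E's covering ball;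
  two implications, NO iff: the flat case `Λ = 0` is NOT decided by the first order. (File (3): since `γ` depends on
  the direction only, `gamma_smul`, the slice is no restriction and `Λ < 0 ⇒ IsLocalMax γ a` on `Dir`.)
NOT here (honest): which lattice directions have `Λ < 0` — none of the four named ones (ascent rays, DATA), and S-E′'s
«`B(t₀) > 0` at the lattice maximisers» is NOT addressed; the quantitative halves live on Lemma B's coherence ball
(intersected with g23's stability ball), not on S-E's covering ball of radius `1/(2λ₀)` — S-E stays CONJECTURED; the
loss loci and closed-box faces (not Regular / not open-box) are not covered; no value of `Λ`, `σ`, `Q`, `γ` at a named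
direction enters a statement; nothing about C2 or `ζ(5)`.
-/

noncomputable section

open Set MeasureTheory Filter
open scoped Topology

namespace Summit.KontsevichZagierPeriods.Zeta5Search.Barrier.ConeGamma

/-! ### `Λ` controls `γ` to first order on the ball -/

/-- **`Λ` CONTROLS `γ` TO FIRST ORDER ON THE BALL.** At a Regular open-box direction `a` with `Q = C₁ + δ₂₈ − Φ > 0`,
`T > 0` a period, and `x` ANY displacement carrying the modulus bound (`σ(δ) ≤ σ(x)·(r_M(δ) − r_m(δ))` for every `δ`
and every slowest / fastest pair — (i) of P2 g36's `exists_modulus_ray`, `σ(x) = Λ(a,T)`): there are `C′` and `r > 0`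
such that for EVERY `η` with `0 < Y(η) ≤ r` and every slowest / fastest pair `(m, M)` of its rates:
`γ(s(a)+η) − γ(a) ≤ ((C₁−C₀)/Q²)·(σ(x)·(r_M(η) − r_m(η))/T)·log(1/Y(η)) + C′·Y(η)`. Either sign of `σ(x)`
(`∂γ/∂Φ = (C₁−C₀)/Q² > 0` by `C0_lt_C1_of_regular`). No value of `Λ` at a named direction is asserted; this ball is
Lemma B's coherence ball, not S-E's covering ball (S-E CONJECTURED). -/
theorem gamma_sub_le_modulus_nhds_of_regular {a : Dir}
    (hopen : ∀ j : Fin 7, 0 < sParam a j.succ ∧ sParam a j.succ < sParam a 0) (hreg : Regular a)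
    (hQ : 0 < C1 a + delta28 a - phi30 a) {T : ℝ} (hT : 0 < T)
    (hper : ∀ k : Fin 28, ∃ z : ℤ, T * h28 a k = z) {x : Fin 8 → ℝ}
    (hmod : ∀ δ : Fin 8 → ℝ, ∀ m M : Fin 28, (∀ k, phiForm δ m / h28 a m ≤ phiForm δ k / h28 a k ∧
        phiForm δ k / h28 a k ≤ phiForm δ M / h28 a M) →
      cuspSlope a T δ ≤ cuspSlope a T x * (phiForm δ M / h28 a M - phiForm δ m / h28 a m)) :
    ∃ C' r : ℝ, 0 < r ∧ ∀ η : Fin 8 → ℝ, 0 < shiftSize η → shiftSize η ≤ r →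
      ∀ m M : Fin 28, (∀ k, phiForm η m / h28 a m ≤ phiForm η k / h28 a k ∧
          phiForm η k / h28 a k ≤ phiForm η M / h28 a M) →
        gamma (aOfS (sParam a + η)) - gamma a
          ≤ (C1 a - C0 a) / (C1 a + delta28 a - phi30 a) ^ 2
              * (cuspSlope a T x * (phiForm η M / h28 a M - phiForm η m / h28 a m) / T)
              * Real.log (1 / shiftSize η) + C' * shiftSize η := by
  obtain ⟨C', r, hr, h⟩ := gamma_logCusp_nhds_of_regular hopen hreg hQ hT hper
  refine ⟨C', min r 1, lt_min hr one_pos, fun η hY hYr m M hmM => ?_⟩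
  have hmain := (abs_le.mp (h η hY (hYr.trans (min_le_left _ _)))).2
  have hL : 0 ≤ Real.log (1 / shiftSize η) :=
    Real.log_nonneg ((one_le_div hY).mpr (hYr.trans (min_le_right _ _)))
  have hκ : 0 ≤ (C1 a - C0 a) / (C1 a + delta28 a - phi30 a) ^ 2 :=
    div_nonneg (sub_nonneg.mpr (C0_lt_C1_of_regular hreg).le) (sq_nonneg _)
  have hσ : (C1 a - C0 a) / (C1 a + delta28 a - phi30 a) ^ 2 * (cuspSlope a T η / T)
        * Real.log (1 / shiftSize η)
      ≤ (C1 a - C0 a) / (C1 a + delta28 a - phi30 a) ^ 2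
          * (cuspSlope a T x * (phiForm η M / h28 a M - phiForm η m / h28 a m) / T)
          * Real.log (1 / shiftSize η) :=
    mul_le_mul_of_nonneg_right (mul_le_mul_of_nonneg_left
      (div_le_div_of_nonneg_right (hmod η m M hmM) hT.le) hκ) hL
  linarith

/-! ### `Λ < 0`: cusp-type descent of `γ` on the slice `η₀ = 0` -/

/-- **`Λ < 0 ⇒` CUSP-TYPE DESCENT OF `γ` ON THE SLICE, UNIFORMLY.** At a Regular open-box direction with `Q > 0`,
`T > 0` a period, `x` carrying the modulus bound with `σ(x) < 0`: there are `C′` and `r > 0` with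
`γ(s(a)+η) − γ(a) ≤ ((C₁−C₀)/Q²)·(σ(x)/(T·(x_max + 3x_max²/(2s₀))))·Y(η)·log(1/Y(η)) + C′·Y(η)` for EVERY slice
displacement `η` (`η₀ = 0`) with `0 < Y(η) ≤ r` — the S-E′ shape `−B·Y·log(1/Y) + C′·Y`, `B > 0`, FOR `γ`, on
Lemma B's coherence ball (on the slice the spread is a norm, P2 g37's `shiftSize_le_mul_spread_of_apply_zero`). -/
theorem gamma_sub_le_neg_on_slice_of_regular {a : Dir}
    (hopen : ∀ j : Fin 7, 0 < sParam a j.succ ∧ sParam a j.succ < sParam a 0) (hreg : Regular a)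
    (hQ : 0 < C1 a + delta28 a - phi30 a) {T : ℝ} (hT : 0 < T)
    (hper : ∀ k : Fin 28, ∃ z : ℤ, T * h28 a k = z) {x : Fin 8 → ℝ}
    (hmod : ∀ δ : Fin 8 → ℝ, ∀ m M : Fin 28, (∀ k, phiForm δ m / h28 a m ≤ phiForm δ k / h28 a k ∧
        phiForm δ k / h28 a k ≤ phiForm δ M / h28 a M) →
      cuspSlope a T δ ≤ cuspSlope a T x * (phiForm δ M / h28 a M - phiForm δ m / h28 a m))
    (hneg : cuspSlope a T x < 0) :
    ∃ C' r : ℝ, 0 < r ∧ ∀ η : Fin 8 → ℝ, η 0 = 0 → 0 < shiftSize η → shiftSize η ≤ r →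
      gamma (aOfS (sParam a + η)) - gamma a
        ≤ (C1 a - C0 a) / (C1 a + delta28 a - phi30 a) ^ 2
            * (cuspSlope a T x / (T * (xMax a + 3 * xMax a ^ 2 / (2 * sParam a 0)))) * shiftSize η
            * Real.log (1 / shiftSize η) + C' * shiftSize η := by
  have hpos := h28_pos_of_openBox hopen
  obtain ⟨C', r, hr, h⟩ := gamma_sub_le_modulus_nhds_of_regular hopen hreg hQ hT hper hmod
  refine ⟨C', min r 1, lt_min hr one_pos, fun η h0 hY hYr => ?_⟩
  obtain ⟨m, -, hm⟩ := Finset.exists_min_image Finset.univ (fun k => phiForm η k / h28 a k) Finset.univ_nonempty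
  obtain ⟨M, -, hM⟩ := Finset.exists_max_image Finset.univ (fun k => phiForm η k / h28 a k) Finset.univ_nonempty
  have hmM : ∀ k, phiForm η m / h28 a m ≤ phiForm η k / h28 a k ∧ phiForm η k / h28 a k ≤ phiForm η M / h28 a M :=
    fun k => ⟨hm k (Finset.mem_univ _), hM k (Finset.mem_univ _)⟩
  have hmain := h η hY (hYr.trans (min_le_left _ _)) m M hmM
  have hL : 0 ≤ Real.log (1 / shiftSize η) :=
    Real.log_nonneg ((one_le_div hY).mpr (hYr.trans (min_le_right _ _)))
  have hκs : 0 < xMax a + 3 * xMax a ^ 2 / (2 * sParam a 0) := by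
    have := xMax_pos hpos; have := sParam_zero_pos hpos; positivity
  have hκ : 0 ≤ (C1 a - C0 a) / (C1 a + delta28 a - phi30 a) ^ 2 :=
    div_nonneg (sub_nonneg.mpr (C0_lt_C1_of_regular hreg).le) (sq_nonneg _)
  have hcmp := shiftSize_le_mul_spread_of_apply_zero hpos h0 hmM
  -- `σ(x) < 0` turns the lower bound on the spread into an upper bound on the cusp term
  have hstep : cuspSlope a T x * (phiForm η M / h28 a M - phiForm η m / h28 a m)
      ≤ cuspSlope a T x * (shiftSize η / (xMax a + 3 * xMax a ^ 2 / (2 * sParam a 0))) := by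
    refine mul_le_mul_of_nonpos_left ?_ hneg.le
    rwa [div_le_iff₀' hκs]
  have hstep' := mul_le_mul_of_nonneg_right (mul_le_mul_of_nonneg_left
    (div_le_div_of_nonneg_right hstep hT.le) hκ) hL
  have e : (C1 a - C0 a) / (C1 a + delta28 a - phi30 a) ^ 2
        * (cuspSlope a T x * (shiftSize η / (xMax a + 3 * xMax a ^ 2 / (2 * sParam a 0))) / T)
      = (C1 a - C0 a) / (C1 a + delta28 a - phi30 a) ^ 2
          * (cuspSlope a T x / (T * (xMax a + 3 * xMax a ^ 2 / (2 * sParam a 0)))) * shiftSize η := by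
    field_simp
  rw [e] at hstep'
  linarith

/-- **`Λ < 0 ⇒ γ(s(a)+η) < γ(a)` ON THE SLICE near `0`** (modulus form). At a Regular open-box direction with `Q > 0`,
`T > 0` a period, `x` carrying the modulus bound with `σ(x) < 0` (`Λ(a,T) < 0`): there is `r > 0` with
`γ(s(a)+η) < γ(a)` for EVERY slice displacement `η₀ = 0` with `0 < Y(η) ≤ r`. (The negative `Y·log(1/Y)` term beats
`C′·Y` once `log(1/Y) ≥ (|C′|+1)/B`; `r` is at most Lemma B's coherence radius — this ball is Lemma B's coherence
ball, not S-E's covering ball; S-E stays CONJECTURED.) No named direction is asserted to satisfy the hypothesis (at the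
four named directions ascent rays exist — DATA); the flat case `Λ = 0` is not decided. -/
theorem gamma_lt_on_slice_of_modulus_neg_of_regular {a : Dir}
    (hopen : ∀ j : Fin 7, 0 < sParam a j.succ ∧ sParam a j.succ < sParam a 0) (hreg : Regular a)
    (hQ : 0 < C1 a + delta28 a - phi30 a) {T : ℝ} (hT : 0 < T)
    (hper : ∀ k : Fin 28, ∃ z : ℤ, T * h28 a k = z) {x : Fin 8 → ℝ}
    (hmod : ∀ δ : Fin 8 → ℝ, ∀ m M : Fin 28, (∀ k, phiForm δ m / h28 a m ≤ phiForm δ k / h28 a k ∧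
        phiForm δ k / h28 a k ≤ phiForm δ M / h28 a M) →
      cuspSlope a T δ ≤ cuspSlope a T x * (phiForm δ M / h28 a M - phiForm δ m / h28 a m))
    (hneg : cuspSlope a T x < 0) :
    ∃ r : ℝ, 0 < r ∧ ∀ η : Fin 8 → ℝ, η 0 = 0 → 0 < shiftSize η → shiftSize η ≤ r →
      gamma (aOfS (sParam a + η)) < gamma a := by
  have hpos := h28_pos_of_openBox hopen
  obtain ⟨C', r, hr, h⟩ := gamma_sub_le_neg_on_slice_of_regular hopen hreg hQ hT hper hmod hneg
  -- the descent rate `B = −(∂γ/∂Φ)·σ(x)/(T·κ) > 0` and the threshold `L₀ = (|C′|+1)/B`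
  obtain ⟨B, hB⟩ : ∃ B : ℝ, B = -((C1 a - C0 a) / (C1 a + delta28 a - phi30 a) ^ 2
      * (cuspSlope a T x / (T * (xMax a + 3 * xMax a ^ 2 / (2 * sParam a 0))))) := ⟨_, rfl⟩
  have hκs : 0 < xMax a + 3 * xMax a ^ 2 / (2 * sParam a 0) := by
    have := xMax_pos hpos; have := sParam_zero_pos hpos; positivity
  have hκ : 0 < (C1 a - C0 a) / (C1 a + delta28 a - phi30 a) ^ 2 :=
    div_pos (sub_pos.mpr (C0_lt_C1_of_regular hreg)) (pow_pos hQ 2)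
  have hBpos : 0 < B := by
    rw [hB, neg_pos]; exact mul_neg_of_pos_of_neg hκ (div_neg_of_neg_of_pos hneg (mul_pos hT hκs))
  obtain ⟨L₀, hL₀⟩ : ∃ L₀ : ℝ, L₀ = (|C'| + 1) / B := ⟨_, rfl⟩
  refine ⟨min r (Real.exp (-L₀)), lt_min hr (Real.exp_pos _), fun η h0 hY hYr => ?_⟩
  have hmain := h η h0 hY (hYr.trans (min_le_left _ _))
  rw [show (C1 a - C0 a) / (C1 a + delta28 a - phi30 a) ^ 2
      * (cuspSlope a T x / (T * (xMax a + 3 * xMax a ^ 2 / (2 * sParam a 0)))) = -B by rw [hB, neg_neg]] at hmain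
  -- `log(1/Y) ≥ L₀`
  have hL : L₀ ≤ Real.log (1 / shiftSize η) := by
    have h1 : Real.exp L₀ ≤ 1 / shiftSize η := by
      rw [le_div_iff₀ hY]
      calc Real.exp L₀ * shiftSize η ≤ Real.exp L₀ * Real.exp (-L₀) :=
            mul_le_mul_of_nonneg_left (hYr.trans (min_le_right _ _)) (Real.exp_pos _).le
        _ = 1 := by rw [← Real.exp_add, add_neg_cancel, Real.exp_zero]
    have := Real.log_le_log (Real.exp_pos _) h1
    rwa [Real.log_exp] at this
  have hBL : |C'| + 1 ≤ B * Real.log (1 / shiftSize η) := by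
    have := mul_le_mul_of_nonneg_left hL hBpos.le
    rwa [hL₀, mul_div_cancel₀ _ hBpos.ne'] at this
  have hC := le_abs_self C'
  nlinarith

/-! ### `Λ > 0`: an ascent direction excludes a local maximum of `γ` on the slice
(germ statement; coherence ∩ stability radius, not S-E's ball) -/

/-- **ONE ASCENT DIRECTION EXCLUDES A LOCAL MAXIMUM OF `γ` on the slice `η₀ = 0`, on every ball** (a germ statement at a
Regular open-box direction; the expansion behind it lives on Lemma B's coherence radius ∩ P2 g23's stability radius —
NOT S-E's covering ball, S-E / S-E′ CONJECTURED). At a Regular open-box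
direction with `Q > 0`, a period `T`, and ANY displacement `x` with `cuspSlope a T x > 0` (e.g. the modulus ray when
`Λ > 0`): inside every `Y`-ball there is a slice displacement `η` (`η₀ = 0`, `0 < Y(η) ≤ r`) with `γ(s(a)+η) > γ(a)`.
(Gauge `x` into the slice — `cuspSlope_add_smul_sParam` — and shrink it: the positive `Y·log(1/Y)` term of file (1)'s
ball expansion, coefficient `(∂γ/∂Φ)·σ(x)/(T·Y(x′)) > 0`, beats `C′·Y`.) -/
theorem exists_gamma_gt_on_slice_of_cuspSlope_pos_of_regular {a : Dir}
    (hopen : ∀ j : Fin 7, 0 < sParam a j.succ ∧ sParam a j.succ < sParam a 0) (hreg : Regular a)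
    (hQ : 0 < C1 a + delta28 a - phi30 a) {T : ℝ} (hT : 0 < T)
    (hper : ∀ k : Fin 28, ∃ z : ℤ, T * h28 a k = z) {x : Fin 8 → ℝ}
    (hxpos : 0 < cuspSlope a T x) {r : ℝ} (hr : 0 < r) :
    ∃ η : Fin 8 → ℝ, η 0 = 0 ∧ 0 < shiftSize η ∧ shiftSize η ≤ r ∧ gamma a < gamma (aOfS (sParam a + η)) := by
  have hpos := h28_pos_of_openBox hopen
  have hs0 := sParam_zero_pos hpos
  obtain ⟨C, r₀, hr₀, h⟩ := gamma_logCusp_nhds_of_regular hopen hreg hQ hT hper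
  have hκ : 0 < (C1 a - C0 a) / (C1 a + delta28 a - phi30 a) ^ 2 :=
    div_pos (sub_pos.mpr (C0_lt_C1_of_regular hreg)) (pow_pos hQ 2)
  -- the slice representative of `x`
  obtain ⟨x', hx'⟩ : ∃ x' : Fin 8 → ℝ, x' = x + (-(x 0 / sParam a 0)) • sParam a := ⟨_, rfl⟩
  have hx'0 : x' 0 = 0 := by rw [hx']; simp; field_simp; ring
  have hσ' : cuspSlope a T x' = cuspSlope a T x := by rw [hx']; exact cuspSlope_add_smul_sParam hpos hT hper x _
  have hY' : 0 < shiftSize x' := by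
    rcases (shiftSize_nonneg x').eq_or_lt with h0 | h0
    · exfalso
      have hz : x' = 0 := eq_zero_of_forall_phiForm_eq_zero fun k =>
        abs_nonpos_iff.mp (h0 ▸ abs_phiForm_le_shiftSize x' k)
      rw [hz, cuspSlope_zero] at hσ'
      linarith
    · exact h0
  -- the rate `A = (∂γ/∂Φ)·σ(x)/(T·Y(x')) > 0`, the threshold `L₀ = (|C|+1)/A`, the size `y`
  obtain ⟨A, hA⟩ : ∃ A : ℝ, A = (C1 a - C0 a) / (C1 a + delta28 a - phi30 a) ^ 2
      * (cuspSlope a T x / (T * shiftSize x')) := ⟨_, rfl⟩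
  have hApos : 0 < A := by rw [hA]; exact mul_pos hκ (div_pos hxpos (mul_pos hT hY'))
  obtain ⟨L₀, hL₀⟩ : ∃ L₀ : ℝ, L₀ = (|C| + 1) / A := ⟨_, rfl⟩
  obtain ⟨y, hy⟩ : ∃ y : ℝ, y = min (min r r₀) (Real.exp (-L₀)) := ⟨_, rfl⟩
  have hypos : 0 < y := by rw [hy]; exact lt_min (lt_min hr hr₀) (Real.exp_pos _)
  have hyr : y ≤ r := by rw [hy]; exact (min_le_left _ _).trans (min_le_left _ _)
  have hyr₀ : y ≤ r₀ := by rw [hy]; exact (min_le_left _ _).trans (min_le_right _ _)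
  have hyL : y ≤ Real.exp (-L₀) := by rw [hy]; exact min_le_right _ _
  -- the displacement `η = (y/Y(x'))•x'`
  have ht : 0 < y / shiftSize x' := div_pos hypos hY'
  refine ⟨(y / shiftSize x') • x', by simp [hx'0], ?_, ?_, ?_⟩
  · rw [shiftSize_smul, abs_of_pos ht]; exact mul_pos ht hY'
  · rw [shiftSize_smul, abs_of_pos ht, div_mul_cancel₀ _ hY'.ne']; exact hyr
  · have hYη : shiftSize ((y / shiftSize x') • x') = y := by
      rw [shiftSize_smul, abs_of_pos ht, div_mul_cancel₀ _ hY'.ne']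
    have hmain := (abs_le.mp (h _ (by rw [hYη]; exact hypos) (by rw [hYη]; exact hyr₀))).1
    rw [hYη, cuspSlope_smul hpos hT hper x' ht, hσ'] at hmain
    -- `log(1/y) ≥ L₀`
    have hL : L₀ ≤ Real.log (1 / y) := by
      have h1 : Real.exp L₀ ≤ 1 / y := by
        rw [le_div_iff₀ hypos]
        calc Real.exp L₀ * y ≤ Real.exp L₀ * Real.exp (-L₀) := mul_le_mul_of_nonneg_left hyL (Real.exp_pos _).le
          _ = 1 := by rw [← Real.exp_add, add_neg_cancel, Real.exp_zero]
      have := Real.log_le_log (Real.exp_pos _) h1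
      rwa [Real.log_exp] at this
    have hAL : |C| + 1 ≤ A * Real.log (1 / y) := by
      have := mul_le_mul_of_nonneg_left hL hApos.le
      rwa [hL₀, mul_div_cancel₀ _ hApos.ne'] at this
    have e : (C1 a - C0 a) / (C1 a + delta28 a - phi30 a) ^ 2
          * (y / shiftSize x' * cuspSlope a T x / T) * Real.log (1 / y) = y * (A * Real.log (1 / y)) := by
      rw [hA]; field_simp
    rw [e] at hmain
    have hC := le_abs_self C
    nlinarith

/-! ### Packaged with the modulus ray: the sign of `Λ` decides, on the slice -/

/-- **STRICT CUSP TOP `⇒ γ(s(a)+η) < γ(a)` ON THE SLICE near `0`** (inputs: a Regular open-box direction with `Q > 0`,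
a period, strictness). If `cuspSlope a T δ < 0` for every non-radial `δ` (two distinct rates) — by P2 g36 `⇔ Λ(a,T) <
0` — then for some `r > 0`: `γ(s(a)+η) < γ(a)` for every slice displacement `η₀ = 0` with `0 < Y(η) ≤ r`. (The
modulus ray of `exists_modulus_ray_canonical` carries the bound; `forall_cuspSlope_neg_iff_modulus_neg`.) No named
direction is asserted to be a strict cusp top; the flat case `Λ = 0` is not decided; this ball is Lemma B's coherence
ball, not S-E's covering ball (S-E CONJECTURED). -/
theorem gamma_lt_on_slice_of_strict_of_regular {a : Dir}
    (hopen : ∀ j : Fin 7, 0 < sParam a j.succ ∧ sParam a j.succ < sParam a 0) (hreg : Regular a)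
    (hQ : 0 < C1 a + delta28 a - phi30 a) {T : ℝ} (hT : 0 < T)
    (hper : ∀ k : Fin 28, ∃ z : ℤ, T * h28 a k = z)
    (hstrict : ∀ δ : Fin 8 → ℝ, (∃ k l, phiForm δ k / h28 a k ≠ phiForm δ l / h28 a l) → cuspSlope a T δ < 0) :
    ∃ r : ℝ, 0 < r ∧ ∀ η : Fin 8 → ℝ, η 0 = 0 → 0 < shiftSize η → shiftSize η ≤ r →
      gamma (aOfS (sParam a + η)) < gamma a := by
  classical
  obtain ⟨x, -, -, ⟨hxne, -⟩, hmod, -⟩ := exists_modulus_ray_canonical (h28_pos_of_openBox hopen) hT hper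
    (F := fun A => ∑ m ∈ Finset.range ((bkpts a T).card - 1), ((patternN a (bkpt a T m) A : ℤ) : ℝ)) fun _ => rfl
  exact gamma_lt_on_slice_of_modulus_neg_of_regular hopen hreg hQ hT hper hmod
    ((forall_cuspSlope_neg_iff_modulus_neg hxne hmod).mp hstrict)

/-- **THE DICHOTOMY FOR `γ` ON THE SLICE.** At a Regular open-box direction with `Q > 0` and a period `T`:
(1) `σ < 0` in every non-radial direction (`⇔ Λ < 0`) `⇒ γ(s(a)+η) < γ(a)` for all `η₀ = 0`, `0 < Y(η) ≤ r`;
(2) `σ > 0` in SOME direction (`⇔ Λ > 0`) `⇒` inside every `Y`-ball some slice displacement has `γ(s(a)+η) > γ(a)`.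
Two implications, no «iff»: the flat case `Λ = 0` is NOT decided. Which case a lattice direction is in is NOT
asserted (at the four named directions it is case (2), DATA). -/
theorem gamma_slice_dichotomy_of_regular {a : Dir}
    (hopen : ∀ j : Fin 7, 0 < sParam a j.succ ∧ sParam a j.succ < sParam a 0) (hreg : Regular a)
    (hQ : 0 < C1 a + delta28 a - phi30 a) {T : ℝ} (hT : 0 < T)
    (hper : ∀ k : Fin 28, ∃ z : ℤ, T * h28 a k = z) :
    ((∀ δ : Fin 8 → ℝ, (∃ k l, phiForm δ k / h28 a k ≠ phiForm δ l / h28 a l) → cuspSlope a T δ < 0) →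
      ∃ r : ℝ, 0 < r ∧ ∀ η : Fin 8 → ℝ, η 0 = 0 → 0 < shiftSize η → shiftSize η ≤ r →
        gamma (aOfS (sParam a + η)) < gamma a) ∧
    ((∃ δ : Fin 8 → ℝ, 0 < cuspSlope a T δ) →
      ∀ r : ℝ, 0 < r → ∃ η : Fin 8 → ℝ, η 0 = 0 ∧ 0 < shiftSize η ∧ shiftSize η ≤ r ∧
        gamma a < gamma (aOfS (sParam a + η))) :=
  ⟨fun hstrict => gamma_lt_on_slice_of_strict_of_regular hopen hreg hQ hT hper hstrict,
    fun ⟨_, hδ⟩ _ hr => exists_gamma_gt_on_slice_of_cuspSlope_pos_of_regular hopen hreg hQ hT hper hδ hr⟩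

/-- **STRICT CUSP TOP ⇒ `IsLocalMaxOn` FOR `γ`** on the slice `η₀ = 0` (Mathlib's vocabulary): at a Regular open-box
direction with `Q > 0`, if `σ < 0` in every non-radial direction then `η ↦ γ(aOfS(s(a)+η))` has a local maximum at `0`
on `{η | η₀ = 0}`, where `IsLocalMaxOn` here is a GERM statement whose quantitative radius is Lemma B's coherence
radius ∩ P2 g23's stability radius — NOT S-E's covering ball (S-E / S-E′ CONJECTURED). One implication; the flat case
`Λ = 0` is NOT decided and no iff is claimed; no named direction is asserted to satisfy the hypothesis. -/
theorem isLocalMaxOn_gamma_slice_of_strict_of_regular {a : Dir}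
    (hopen : ∀ j : Fin 7, 0 < sParam a j.succ ∧ sParam a j.succ < sParam a 0) (hreg : Regular a)
    (hQ : 0 < C1 a + delta28 a - phi30 a) {T : ℝ} (hT : 0 < T)
    (hper : ∀ k : Fin 28, ∃ z : ℤ, T * h28 a k = z)
    (hstrict : ∀ δ : Fin 8 → ℝ, (∃ k l, phiForm δ k / h28 a k ≠ phiForm δ l / h28 a l) → cuspSlope a T δ < 0) :
    IsLocalMaxOn (fun η : Fin 8 → ℝ => gamma (aOfS (sParam a + η))) {η | η 0 = 0} 0 := by
  obtain ⟨r, hr, h⟩ := gamma_lt_on_slice_of_strict_of_regular hopen hreg hQ hT hper hstrict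
  have hball : Metric.ball (0 : Fin 8 → ℝ) (r / 2) ∈ 𝓝[{η | η 0 = 0}] (0 : Fin 8 → ℝ) :=
    mem_nhdsWithin_of_mem_nhds (Metric.ball_mem_nhds 0 (by linarith))
  refine Filter.mem_of_superset (Filter.inter_mem hball self_mem_nhdsWithin) ?_
  rintro η ⟨hηball, hη0⟩
  simp only [Set.mem_setOf_eq] at hη0 ⊢
  rw [add_zero, aOfS_sParam]
  have hnorm : ‖η‖ < r / 2 := by simpa using hηball
  have hYr : shiftSize η ≤ r := by linarith [shiftSize_le_two_mul_norm η]
  rcases (shiftSize_nonneg η).eq_or_lt with hY | hY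
  · have hz : η = 0 := eq_zero_of_forall_phiForm_eq_zero fun k =>
      abs_nonpos_iff.mp (hY ▸ abs_phiForm_le_shiftSize η k)
    rw [hz, add_zero, aOfS_sParam]
  · exact (h η hη0 hY hYr).le

/-- **AN ASCENT DIRECTION ⇒ NOT `IsLocalMaxOn` FOR `γ`** on the slice `η₀ = 0`: at a Regular open-box direction with `Q >
0`, if `cuspSlope a T δ > 0` for some `δ`, then `η ↦ γ(aOfS(s(a)+η))` has NO local maximum at `0` on `{η | η₀ = 0}`,
where `IsLocalMaxOn` here is a GERM statement whose quantitative radius is Lemma B's coherence radius ∩ P2 g23's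
stability radius — NOT S-E's covering ball (S-E / S-E′ CONJECTURED). One implication; the flat case is not decided. -/
theorem not_isLocalMaxOn_gamma_slice_of_ascent_of_regular {a : Dir}
    (hopen : ∀ j : Fin 7, 0 < sParam a j.succ ∧ sParam a j.succ < sParam a 0) (hreg : Regular a)
    (hQ : 0 < C1 a + delta28 a - phi30 a) {T : ℝ} (hT : 0 < T)
    (hper : ∀ k : Fin 28, ∃ z : ℤ, T * h28 a k = z) {δ : Fin 8 → ℝ} (hδ : 0 < cuspSlope a T δ) :
    ¬ IsLocalMaxOn (fun η : Fin 8 → ℝ => gamma (aOfS (sParam a + η))) {η | η 0 = 0} 0 := by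
  intro hmax
  have hmax' : ∀ᶠ η in 𝓝[{η | η 0 = 0}] (0 : Fin 8 → ℝ), gamma (aOfS (sParam a + η)) ≤ gamma a := by
    have := hmax
    simp only [IsLocalMaxOn, IsMaxFilter, add_zero, aOfS_sParam] at this
    exact this
  obtain ⟨U, hU, hUsub⟩ := mem_nhdsWithin_iff_exists_mem_nhds_inter.mp hmax'
  obtain ⟨ρ, hρ, hball⟩ := Metric.mem_nhds_iff.mp hU
  obtain ⟨η, hη0, -, hYr, hgt⟩ :=
    exists_gamma_gt_on_slice_of_cuspSlope_pos_of_regular hopen hreg hQ hT hper hδ (show 0 < ρ / 5 by linarith)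
  have hηU : η ∈ U := hball (by
    rw [Metric.mem_ball, dist_zero_right]
    linarith [norm_le_shiftSize η])
  have := hUsub ⟨hηU, hη0⟩
  simp only [Set.mem_setOf_eq] at this
  linarith

end Summit.KontsevichZagierPeriods.Zeta5Search.Barrier.ConeGamma

end
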